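import Mathlib
import Summits.NavierStokesRegularity.NavierStokesRegularity.Theorems.TaoLadderRungTwoBreakOneShiftTubeDefs
import Summits.NavierStokesRegularity.NavierStokesRegularity.Theorems.TaoLadderRungTwoBreakOneShiftFixedPointDatum
import HarnessLib

/-!
# Kernel STAGE 3: the one-shift map on trajectory space is a contraction of a complete invariant set ⟹
# Banach fixed point ⟹ (p621393) surviving admissible DSS wave — END-TO-END, conditional on the window
# certificate and the block estimates in solved form (cell harvest/h2-tao-ladder, seat p2;
# rung1/KERNEL-STAGE3-PLAN.md steps (2)–(4); support for K1(1) = `NoSurvivingDSSOne`, stmt-NavierStokesRegularity-20205)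

MODEL lattice ODEs only (Tao 2016 §4 on Tao's shift set `S`); nothing here is a statement about the
Navier–Stokes equations; no item is closed; CONDITIONAL glue (no certificate instance is in the tree).

Over `…OneShiftMapDefs` (p620787) and `…OneShiftTubeDefs` (p621607):
* `isComplete_admLip` — the invariant set `AdmLip R` (box × tubes × window-indexed tails zero × time-Lipschitz
  tails) is COMPLETE (every clause is a pointwise closed condition in the Banach space
  `(Fin m → Fin W → ℝ) × ℝ × ℓ^∞`; `admLip_iff`);
* `mapsTo_oneShiftMap` — SELF-MAP from the time-Lipschitz bound of the raw Picard–shift outputs alone (box,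
  tubes, vanishing window-indexed tails are automatic by the clamps);
* `dist_oneShiftMap_le` — `q`-LIPSCHITZ from the two block estimates in solved form (raw window block
  `q`-Lipschitz = the engine's (H-lip) row; raw scaled tails `q`-Lipschitz = the Picard–shift rows of
  STAGE3-BANACH's matrix L̃), since the clamps are 1-Lipschitz and the metric is the max over blocks;
* `exists_fixedPoint_oneShiftMap` — Banach (`ContractingWith.exists_fixedPoint'`);
* `exists_surviving_dssWave_of_windowCert` — the END-TO-END statement: window certificate + (i) rate bounds,
  (ii) the two Lipschitz estimates with `q < 1`, (iii) clamps inactive on the invariant set ((H-win) + STAGE 2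
  Lemma 4), (iv) the renormalisation-factor enclosure (`1 < g² ≤ 1+ε₀`, `g < Λ`, `β² < gΛ`), (v) the bottom
  hull, the frame inequalities and a point of the set ⟹ `∃ T > 0, ∃ Φ, IsDSSWave ε₀ α (Equiv.refl Unit) T Φ ∧
  Surviving 1 ε₀ T ∧ Φ ≢ 0`.
What is still taken as hypothesis and where it comes from: (i)/(ii)/(iii)/(iv)/(v) are, row by row, the
numbers of p2's engine v7.5 + s3_checks (rung1/logs/num4c); deriving (i)/(ii) from per-shell Lipschitz/rate
bounds of `quadTerm` on the tubes (table arithmetic, `abs_quadTerm_sub_quadTerm_le`) is the remaining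
refinement; the window certificate itself is the engine's (VALIDATED, unaudited) statement.
-/

noncomputable section

-- `Summit.NavierStokesRegularity.NavierStokesRegularity.…` is the tree's (summit = problem) namespace; the
-- duplicated component is intended, so the dupNamespace linter is silenced for this file.
set_option linter.dupNamespace false

namespace Summit.NavierStokesRegularity.NavierStokesRegularity.Theorems

namespace DSSOneShift

open Set MeasureTheory intervalIntegral
open Literature.Analysis.FluidPDE Literature.Analysis.FluidPDE.TaoCascade CertificateGlueOn

variable {m : ℕ}

namespace OneShiftFrame

variable (F : OneShiftFrame m)

/-! ### Completeness, self-map, contraction, fixed point -/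

/-- The unit clamp is 1-Lipschitz. [folklore] -/
theorem abs_clampUnit_sub_le (x y : ℝ) : |clampUnit x - clampUnit y| ≤ |x - y| := by
  unfold clampUnit
  refine (abs_max_sub_max_le_max _ _ _ _).trans ?_
  rw [sub_self, abs_zero]
  refine max_le (abs_nonneg _) ?_
  refine (abs_min_sub_min_le_max _ _ _ _).trans ?_
  rw [sub_self, abs_zero]
  exact max_le (abs_nonneg _) le_rfl

/-- The tube clamp is 1-Lipschitz. [folklore] -/
theorem abs_clampTail_sub_le (i : Fin m) (k : ℤ) (x y : ℝ) :
    |F.clampTail i k x - F.clampTail i k y| ≤ |x - y| := by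
  unfold clampTail
  split_ifs
  · simp
  · refine (abs_max_sub_max_le_max _ _ _ _).trans ?_
    rw [sub_self, abs_zero]
    refine max_le (abs_nonneg _) ?_
    refine (abs_min_sub_min_le_max _ _ _ _).trans ?_
    rw [sub_self, abs_zero]
    exact max_le (abs_nonneg _) le_rfl

/-- The tube clamp lands in the tube (tail shells). [folklore] -/
theorem clampTail_mem_tube (i : Fin m) {k : ℤ} (hk : ¬ F.InWindow k) (x : ℝ) :
    |F.wt k * F.clampTail i k x - F.tubeC i k| ≤ F.tubeR k := by
  unfold clampTail
  rw [if_neg hk]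
  have hw := F.wt_pos k
  have hR := F.tubeR_nonneg k
  set lo := (F.tubeC i k - F.tubeR k) / F.wt k
  set hi := (F.tubeC i k + F.tubeR k) / F.wt k
  have hlohi : lo ≤ hi := by
    show (F.tubeC i k - F.tubeR k) / F.wt k ≤ (F.tubeC i k + F.tubeR k) / F.wt k
    gcongr; linarith
  have hv1 : lo ≤ max lo (min hi x) := le_max_left _ _
  have hv2 : max lo (min hi x) ≤ hi := max_le hlohi (min_le_left _ _)
  have e1 : F.wt k * lo = F.tubeC i k - F.tubeR k := by
    show F.wt k * ((F.tubeC i k - F.tubeR k) / F.wt k) = _; field_simp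
  have e2 : F.wt k * hi = F.tubeC i k + F.tubeR k := by
    show F.wt k * ((F.tubeC i k + F.tubeR k) / F.wt k) = _; field_simp
  rw [abs_le]
  constructor <;> nlinarith [mul_le_mul_of_nonneg_left hv1 hw.le, mul_le_mul_of_nonneg_left hv2 hw.le]

/-- Coordinate evaluation on `ℓ^∞` is continuous (it is 1-Lipschitz). [folklore] -/
theorem continuous_lp_apply {ι : Type*} (p : ι) : Continuous fun f : lp (fun _ : ι => ℝ) ⊤ => f p := by
  refine (LipschitzWith.of_dist_le_mul (K := 1) fun f g => ?_).continuous
  have h := lp.norm_apply_le_norm ENNReal.top_ne_zero (f - g) p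
  rw [lp.coeFn_sub, Pi.sub_apply] at h
  simpa [dist_eq_norm] using h

/-- `AdmLip` and its clause-wise closed form agree (time-Lipschitz tails are continuous). [folklore] -/
theorem admLip_iff (R : ℤ → ℝ) (u : F.Space) : F.AdmLip R u ↔ F.AdmLip' R u := by
  constructor
  · rintro ⟨⟨h1, h2, _, h4, h5⟩, hL⟩
    exact ⟨h1, h2, h4, h5, hL⟩
  · rintro ⟨h1, h2, h4, h5, hL⟩
    refine ⟨⟨h1, h2, fun i k hk => ?_, h4, h5⟩, hL⟩
    have hlip : LipschitzOnWith (R k).toNNReal (F.decodeTail u i k) (Icc 0 F.τhi) := by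
      refine LipschitzOnWith.of_dist_le_mul fun s hs t ht => ?_
      rw [Real.dist_eq, Real.dist_eq]
      exact (hL i k hk t ht s hs).trans (mul_le_mul_of_nonneg_right (Real.le_coe_toNNReal (R k)) (abs_nonneg _))
    exact hlip.continuousOn

/-- The invariant set (closed form) is closed in the Banach space. [folklore] -/
theorem isClosed_admLip' (R : ℤ → ℝ) : IsClosed {u : F.Space | F.AdmLip' R u} := by
  have hev : ∀ (i : Fin m) (k : ℤ) (t : ℝ), Continuous fun u : F.Space => F.decodeTail u i k t := by
    intro i k t
    unfold decodeTail
    exact continuous_const.mul ((continuous_lp_apply _).comp (continuous_snd.comp continuous_snd))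
  have hev' : ∀ (p : F.TailIdx), Continuous fun u : F.Space => (u.2.2 : F.TailIdx → ℝ) p := fun p =>
    (continuous_lp_apply _).comp (continuous_snd.comp continuous_snd)
  simp only [AdmLip', Set.setOf_and]
  refine IsClosed.inter ?_ (IsClosed.inter ?_ (IsClosed.inter ?_ (IsClosed.inter ?_ ?_)))
  · simp only [Set.setOf_forall]
    exact isClosed_iInter fun i => isClosed_iInter fun k =>
      isClosed_le (((continuous_apply k).comp ((continuous_apply i).comp continuous_fst)).abs)
        continuous_const
  · exact isClosed_le (continuous_fst.comp continuous_snd).abs continuous_const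
  · simp only [Set.setOf_forall]
    exact isClosed_iInter fun i => isClosed_iInter fun k => isClosed_iInter fun _ =>
      isClosed_iInter fun t => isClosed_iInter fun _ =>
        isClosed_le (((hev i k t).sub continuous_const).abs) continuous_const
  · simp only [Set.setOf_forall]
    exact isClosed_iInter fun i => isClosed_iInter fun k => isClosed_iInter fun _ =>
      isClosed_iInter fun t => isClosed_eq (hev' _) continuous_const
  · simp only [Set.setOf_forall]
    exact isClosed_iInter fun i => isClosed_iInter fun k => isClosed_iInter fun _ =>
      isClosed_iInter fun s => isClosed_iInter fun _ => isClosed_iInter fun t => isClosed_iInter fun _ =>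
        isClosed_le (((hev i k t).sub (hev i k s)).abs) continuous_const

/-- **The invariant set is complete** (closed subset of a Banach space). [folklore] -/
theorem isComplete_admLip (R : ℤ → ℝ) : IsComplete {u : F.Space | F.AdmLip R u} := by
  have h : {u : F.Space | F.AdmLip R u} = {u : F.Space | F.AdmLip' R u} := by
    ext u; exact F.admLip_iff R u
  rw [h]
  exact (F.isClosed_admLip' R).isComplete

/-- Decoding the tail block of the image: `decodeTail (𝒯 u) i k t = wt k · clampTail (rawTailScaled u (i,k,t))`
for `t ∈ [0, τ_hi]`. [folklore] -/
theorem decodeTail_oneShiftMap {ε₀ : ℝ} {α : Fin m → Fin m → Fin m → ℤ × ℤ × ℤ → ℝ}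
    (cert : OneShiftWindowCert F ε₀ α) (u : F.Space) (i : Fin m) (k : ℤ) {t : ℝ} (ht : t ∈ Icc 0 F.τhi) :
    F.decodeTail (F.oneShiftMap cert u) i k t =
      F.wt k * F.clampTail i k (F.tailRaw cert u i k t / F.wt k) := by
  unfold decodeTail
  rw [projIcc_of_mem _ ht, F.oneShiftMap_snd_snd_apply]
  rfl

/-- **SELF-MAP.** Under a time-Lipschitz bound for the raw Picard–shift outputs on the invariant set (rate
bounds of the lattice field on the tubes, `R ≥ 0`), `oneShiftMap` maps `AdmLip R` into itself — box, tubes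
and the vanishing of window-indexed tail coordinates are automatic by the clamps.
[cite: Tao2016AveragedNS, §4 Lemma 4.1 (4.8); cell vocabulary, harvest/h2-tao-ladder rung1/STAGE2-LEMMA.md §3 Lemma 4/5 (tubes), rung1/KERNEL-STAGE3-PLAN.md §1] -/
theorem mapsTo_oneShiftMap {ε₀ : ℝ} {α : Fin m → Fin m → Fin m → ℤ × ℤ × ℤ → ℝ}
    (cert : OneShiftWindowCert F ε₀ α) (R : ℤ → ℝ)
    (hrate : ∀ u, F.AdmLip R u → ∀ i k, ¬ F.InWindow k → ∀ s ∈ Icc 0 F.τhi, ∀ t ∈ Icc 0 F.τhi,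
      |F.tailRaw cert u i k t - F.tailRaw cert u i k s| ≤ R k * |t - s|) :
    MapsTo (F.oneShiftMap cert) {u | F.AdmLip R u} {u | F.AdmLip R u} := by
  intro u hu
  rw [Set.mem_setOf_eq, admLip_iff]
  refine ⟨fun i k => F.abs_oneShiftMap_fst_le cert u i k, F.abs_oneShiftMap_tau_le cert u, ?_, ?_, ?_⟩
  · intro i k hk t ht
    rw [F.decodeTail_oneShiftMap cert u i k ht]
    exact F.clampTail_mem_tube i hk _
  · intro i k hk t
    exact F.oneShiftMap_tail_window cert u i hk t
  · intro i k hk s hs t ht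
    rw [F.decodeTail_oneShiftMap cert u i k ht, F.decodeTail_oneShiftMap cert u i k hs, ← mul_sub,
      abs_mul, abs_of_pos (F.wt_pos k)]
    have h1 := F.abs_clampTail_sub_le i k (F.tailRaw cert u i k t / F.wt k) (F.tailRaw cert u i k s / F.wt k)
    have hw := F.wt_pos k
    calc F.wt k * |F.clampTail i k (F.tailRaw cert u i k t / F.wt k) -
          F.clampTail i k (F.tailRaw cert u i k s / F.wt k)|
        ≤ F.wt k * |F.tailRaw cert u i k t / F.wt k - F.tailRaw cert u i k s / F.wt k| :=
          mul_le_mul_of_nonneg_left h1 hw.le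
      _ = |F.tailRaw cert u i k t - F.tailRaw cert u i k s| := by
          rw [← sub_div, abs_div, abs_of_pos hw]; field_simp
      _ ≤ R k * |t - s| := hrate u hu i k hk s hs t ht

/-- **LIPSCHITZ.** If the raw window outputs are `q`-Lipschitz on the invariant set and every raw scaled tail
output is `q`-Lipschitz (the engine's (H-lip) window block and the Picard–shift estimates, in solved form),
then `oneShiftMap` is `q`-Lipschitz there (the clamps are 1-Lipschitz; the metric is the max of the blocks).
[cite: Tao2016AveragedNS, §4; cell vocabulary, harvest/h2-tao-ladder rung1/STAGE3-BANACH.md §2 (the block matrix), rung1/KERNEL-STAGE3-PLAN.md §1] -/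
theorem dist_oneShiftMap_le {ε₀ : ℝ} {α : Fin m → Fin m → Fin m → ℤ × ℤ × ℤ → ℝ}
    (cert : OneShiftWindowCert F ε₀ α) (R : ℤ → ℝ) {q : ℝ} (hq : 0 ≤ q)
    (hW : ∀ u v, F.AdmLip R u → F.AdmLip R v →
      dist (F.rawWindow cert u) (F.rawWindow cert v) ≤ q * dist u v)
    (hT : ∀ u v, F.AdmLip R u → F.AdmLip R v → ∀ p : F.TailIdx, ¬ F.InWindow p.2.1 →
      |F.rawTailScaled cert u p - F.rawTailScaled cert v p| ≤ q * dist u v)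
    {u v : F.Space} (hu : F.AdmLip R u) (hv : F.AdmLip R v) :
    dist (F.oneShiftMap cert u) (F.oneShiftMap cert v) ≤ q * dist u v := by
  have hqd : 0 ≤ q * dist u v := mul_nonneg hq dist_nonneg
  have hWuv := hW u v hu hv
  rw [Prod.dist_eq, Prod.dist_eq]
  refine max_le ?_ (max_le ?_ ?_)
  · -- window block
    refine (dist_pi_le_iff hqd).2 fun i => (dist_pi_le_iff hqd).2 fun k => ?_
    rw [Real.dist_eq, F.oneShiftMap_fst, F.oneShiftMap_fst]
    refine (abs_clampUnit_sub_le _ _).trans ?_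
    have h1 : |(F.rawWindow cert u).1 i k - (F.rawWindow cert v).1 i k| ≤
        dist (F.rawWindow cert u).1 (F.rawWindow cert v).1 := by
      rw [← Real.dist_eq]
      exact (dist_le_pi_dist _ _ k).trans (dist_le_pi_dist _ _ i)
    refine h1.trans (le_trans ?_ hWuv)
    rw [Prod.dist_eq]; exact le_max_left _ _
  · -- flight time
    show dist (F.oneShiftMap cert u).2.1 (F.oneShiftMap cert v).2.1 ≤ q * dist u v
    rw [Real.dist_eq, F.oneShiftMap_snd_fst, F.oneShiftMap_snd_fst]
    refine (abs_clampUnit_sub_le _ _).trans ?_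
    rw [← Real.dist_eq]
    refine le_trans ?_ hWuv
    rw [Prod.dist_eq]; exact le_max_right _ _
  · -- tails
    show dist (F.oneShiftMap cert u).2.2 (F.oneShiftMap cert v).2.2 ≤ q * dist u v
    rw [dist_eq_norm]
    refine lp.norm_le_of_forall_le hqd fun p => ?_
    rw [lp.coeFn_sub, Pi.sub_apply, Real.norm_eq_abs, F.oneShiftMap_snd_snd_apply,
      F.oneShiftMap_snd_snd_apply]
    by_cases hk : F.InWindow p.2.1
    · simp only [clampTail, if_pos hk, sub_self, abs_zero]; exact hqd
    · exact (F.abs_clampTail_sub_le _ _ _ _).trans (hT u v hu hv p hk)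

/-- **BANACH FIXED POINT of the one-shift map.** Complete invariant set + self-map + `q`-Lipschitz with
`q < 1` + a point of the set ⟹ a fixed point in `AdmLip R` (Mathlib `ContractingWith.exists_fixedPoint'`).
[cite: Tao2016AveragedNS, §4–§5; cell vocabulary, harvest/h2-tao-ladder rung1/STAGE3-BANACH.md (Theorem), rung1/KERNEL-STAGE3-PLAN.md §1; Banach fixed-point theorem (folklore)] -/
theorem exists_fixedPoint_oneShiftMap {ε₀ : ℝ} {α : Fin m → Fin m → Fin m → ℤ × ℤ × ℤ → ℝ}
    (cert : OneShiftWindowCert F ε₀ α) (R : ℤ → ℝ) {q : ℝ} (hq : 0 ≤ q) (hq1 : q < 1)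
    (hrate : ∀ u, F.AdmLip R u → ∀ i k, ¬ F.InWindow k → ∀ s ∈ Icc 0 F.τhi, ∀ t ∈ Icc 0 F.τhi,
      |F.tailRaw cert u i k t - F.tailRaw cert u i k s| ≤ R k * |t - s|)
    (hW : ∀ u v, F.AdmLip R u → F.AdmLip R v →
      dist (F.rawWindow cert u) (F.rawWindow cert v) ≤ q * dist u v)
    (hT : ∀ u v, F.AdmLip R u → F.AdmLip R v → ∀ p : F.TailIdx, ¬ F.InWindow p.2.1 →
      |F.rawTailScaled cert u p - F.rawTailScaled cert v p| ≤ q * dist u v)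
    (h0 : ∃ u, F.AdmLip R u) :
    ∃ u, F.AdmLip R u ∧ F.oneShiftMap cert u = u := by
  obtain ⟨u₀, hu₀⟩ := h0
  have hmaps := F.mapsTo_oneShiftMap cert R hrate
  have hlip : LipschitzWith q.toNNReal (hmaps.restrict (F.oneShiftMap cert) _ _) := by
    refine LipschitzWith.of_dist_le_mul fun x y => ?_
    rw [Subtype.dist_eq, Subtype.dist_eq, Real.coe_toNNReal _ hq]
    exact F.dist_oneShiftMap_le cert R hq hW hT x.2 y.2
  have hK : q.toNNReal < 1 := by
    rw [← NNReal.coe_lt_coe, Real.coe_toNNReal _ hq]; exact_mod_cast hq1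
  obtain ⟨u, hus, hfix, -⟩ := ContractingWith.exists_fixedPoint' (F.isComplete_admLip R) hmaps ⟨hK, hlip⟩
    (x := u₀) hu₀ (edist_ne_top _ _)
  exact ⟨u, hus, hfix⟩


/-- **KERNEL STAGE 3 (end-to-end, conditional on the window certificate and the block estimates in solved
form): WINDOW CERTIFICATE ⟹ NON-TRIVIAL (S₁)-SURVIVING ADMISSIBLE DSS WAVE.** Hypotheses: the window
certificate `cert` (p1's `WindowRun` + the Krawczyk map's fixed-point characterisation); on the complete
invariant set `AdmLip R` — (i) time-Lipschitz raw tails (rate bounds), (ii) the raw window block is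
`q`-Lipschitz and every raw scaled tail output is `q`-Lipschitz with `q < 1` ((H-lip) + STAGE3-BANACH's L̃ in
solved form), (iii) the clamps are inactive (raw window output in the box = (H-win); raw tails in their tubes
= STAGE 2 Lemma 4), (iv) the renormalisation factor satisfies `1 < g² ≤ 1+ε₀`, `g < Λ`, `β² < gΛ` (the engine's
μ-enclosure), (v) the bottom window shell is bounded by `Q` along the flight (hull), and the frame inequalities
(wake tubes under `Qβⁿ`, top tubes under `C₀ϱ^{W+j}`, `ϱΛ < 1`, a bottom box interval avoiding `0`), a point of
the set. Conclusion: `∃ T > 0, ∃ Φ, IsDSSWave ε₀ α (Equiv.refl Unit) T Φ ∧ Surviving 1 ε₀ T ∧ Φ ≢ 0`.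
Banach (this file) produces the fixed point; `exists_surviving_dssWave_of_fixedPoint` (p621393) unpacks it.
[cite: Tao2016AveragedNS, §4 Lemma 4.1 (4.8), §5.3–§6; cell vocabulary, harvest/h2-tao-ladder rung1/STAGE2-LEMMA.md, rung1/STAGE3-BANACH.md, rung1/KERNEL-STAGE3-PLAN.md] -/
theorem exists_surviving_dssWave_of_windowCert {ε₀ Mα Q β C₀ ϱ q : ℝ}
    {α : Fin m → Fin m → Fin m → ℤ × ℤ × ℤ → ℝ} (cert : OneShiftWindowCert F ε₀ α) (R : ℤ → ℝ)
    (hε : 0 < 1 + ε₀) (hMα : 0 ≤ Mα) (hα : ∀ i₁ i₂ i₃ μ, |α i₁ i₂ i₃ μ| ≤ Mα) (hW1 : 1 ≤ F.W)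
    (hq : 0 ≤ q) (hq1 : q < 1)
    (hrate : ∀ u, F.AdmLip R u → ∀ i k, ¬ F.InWindow k → ∀ s ∈ Icc 0 F.τhi, ∀ t ∈ Icc 0 F.τhi,
      |F.tailRaw cert u i k t - F.tailRaw cert u i k s| ≤ R k * |t - s|)
    (hW : ∀ u v, F.AdmLip R u → F.AdmLip R v →
      dist (F.rawWindow cert u) (F.rawWindow cert v) ≤ q * dist u v)
    (hT : ∀ u v, F.AdmLip R u → F.AdmLip R v → ∀ p : F.TailIdx, ¬ F.InWindow p.2.1 →
      |F.rawTailScaled cert u p - F.rawTailScaled cert v p| ≤ q * dist u v)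
    (h0 : ∃ u, F.AdmLip R u)
    (hwinIn : ∀ u, F.AdmLip R u →
      (∀ i k, |(F.rawWindow cert u).1 i k| ≤ 1) ∧ |(F.rawWindow cert u).2| ≤ 1)
    (htailIn : ∀ u, F.AdmLip R u → ∀ i k, ¬ F.InWindow k → ∀ t ∈ Icc 0 F.τhi,
      |F.tailRaw cert u i k t - F.tubeC i k| ≤ F.tubeR k)
    (hg : ∀ u, F.AdmLip R u →
      1 < gfac (slice (F.fullFamily cert u) (F.decodeTau u)) ^ 2 ∧
        gfac (slice (F.fullFamily cert u) (F.decodeTau u)) ^ 2 ≤ 1 + ε₀ ∧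
        gfac (slice (F.fullFamily cert u) (F.decodeTau u)) < bigLam ε₀ ∧
        β ^ 2 < gfac (slice (F.fullFamily cert u) (F.decodeTau u)) * bigLam ε₀)
    (hQ : 0 ≤ Q) (hβ1 : 1 ≤ β)
    (hwakeTube : ∀ i (n : ℕ), 1 ≤ n → |F.tubeC i (-(n : ℤ))| + F.tubeR (-(n : ℤ)) ≤ Q * β ^ n)
    (hhull0 : ∀ u, F.AdmLip R u → ∀ i, ∀ s ∈ Icc 0 F.τhi, |F.fullFamily cert u i 0 s| ≤ Q)
    (hϱ : 0 < ϱ) (hϱ1 : ϱ * bigLam ε₀ < 1) (hC₀ : 0 ≤ C₀)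
    (htopTube : ∀ i (j : ℕ), |F.tubeC i ((F.W : ℤ) + j)| + F.tubeR ((F.W : ℤ) + j) ≤ C₀ * ϱ ^ (F.W + j))
    (hne : ∃ i, F.a i 0 < |F.yc i 0|) :
    ∃ (T : ℝ) (Φ : Unit → ℝ → Em m), 0 < T ∧ IsDSSWave ε₀ α (Equiv.refl Unit) T Φ ∧ Surviving 1 ε₀ T ∧
      ∃ x, Φ () x ≠ 0 := by
  obtain ⟨u, hu, hfix⟩ := F.exists_fixedPoint_oneShiftMap cert R hq hq1 hrate hW hT h0
  obtain ⟨hg1, hg2, hgΛ, hr⟩ := hg u hu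
  have hA : F.Adm u := hu.1
  -- the raw window output at an admissible point is the Krawczyk map on the DECODED data
  have hraw : F.rawWindow cert u =
      (fun (i : Fin m) (k : Fin F.W) =>
        ((cert.Nmap (F.decodeTail u) (F.decodeY u, F.decodeTau u)).1 i (k : ℤ) - F.yc i k) / F.a i k,
        ((cert.Nmap (F.decodeTail u) (F.decodeY u, F.decodeTau u)).2 - F.τc) / F.rτ) := by
    unfold rawWindow
    rw [F.preclampTail_eq_decodeTail_fun hA, F.preclampY_eq_decodeY hA, F.preclampTau_eq_decodeTau hA]
  obtain ⟨hwY, hwτ⟩ := hwinIn u hu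
  rw [hraw] at hwY hwτ
  exact F.exists_surviving_dssWave_of_fixedPoint cert hε hMα hα hW1 hA hfix hwY hwτ (htailIn u hu) hg1 hg2
    hgΛ hQ hβ1 hr hwakeTube (hhull0 u hu) hϱ hϱ1 hC₀ htopTube hne


end OneShiftFrame

end DSSOneShift

end Summit.NavierStokesRegularity.NavierStokesRegularity.Theorems
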